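import Summits.Ventures.PercRepro.PuncturedLYMAvoidInst_1
import Summits.Ventures.PercRepro.PuncturedLYMAvoidInst_2
import Summits.Ventures.PercRepro.PuncturedLYMAvoidInst_3
import Summits.Ventures.PercRepro.PuncturedLYMAvoidInst_4
import Summits.Ventures.PercRepro.PuncturedLYMAvoidInst_5
import Summits.Ventures.PercRepro.PuncturedLYMAvoidInst_6
import Summits.Ventures.PercRepro.PuncturedLYMAvoidInst_7
import Summits.Ventures.PercRepro.PuncturedLYMAvoidInst_8
import Summits.Ventures.PercRepro.PuncturedLYMAvoidInst_9
import Summits.Ventures.PercRepro.PuncturedLYMAvoidInst_10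
import Summits.Ventures.PercRepro.PuncturedLYMAvoidInst_11
import Summits.Ventures.PercRepro.PuncturedLYMAvoidInst_12
import Summits.Ventures.PercRepro.PuncturedLYMAvoidInst_13
import Summits.Ventures.PercRepro.PuncturedLYMAvoidInst_14
import Summits.Ventures.PercRepro.PuncturedLYMAvoidInst_15
import Summits.Ventures.PercRepro.PuncturedLYMAvoidInst_16
import Summits.Ventures.PercRepro.PuncturedLYMChainFifteen

/-!
# PercRepro — (SP) BY SUPERPOSITION, PART 14c: THEOREM F — (SP) FOR EVERY CODE WITH `j ≤ 24` AND `2j + 1 ≤ n`; (NC) FOR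
EVERY SPARSE PAVING MATROID OF CORANK `≤ 24` (p10, gen 32)

With the point-avoiding certificate instances (PuncturedLYMAvoidInst_*) on every `(n, j)` with `16 ≤ j ≤ 24`,
`2j + 1 ≤ n ≤ 3j − 3`, Theorem A sharp above `3j − 2` and Theorem E below `j = 16`:
* **`puncturedNMP_of_le_twentyfour`** — (SP) for every code with `1 ≤ j ≤ 24` and `2j + 1 ≤ n`;
* `puncturedNMP_in_of_le_twentyfour` — the same inside any finset;
* **`normConsAt_of_sparsePaving_corank_le_twentyfour`** — (NC) for every sparse paving matroid of corank `n − r ≤ 24` with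
  `r + 1 ≤ n ≤ 2r − 2`, on any ground set.
The pairs `(n, j)` with `j ≥ 25` and `2j + 1 ≤ n ≤ 3j − 3` are NOT covered here (the same bound is below `1` on every
pair tested up to `j = 200`; only the instances are missing).  Nothing here asserts (SP) in general.
-/

open scoped Matroid

namespace PercRepro.PuncturedLYM

open Finset

variable {α : Type} [Fintype α] [DecidableEq α]

/-- **THEOREM F: (SP) holds for every code with `1 ≤ j ≤ 24` and `2j + 1 ≤ n`.** -/
theorem puncturedNMP_of_le_twentyfour {j : ℕ} {D : Finset (Finset α)} (hD : IsCode j D) (hj1 : 1 ≤ j) (hj : j ≤ 24)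
    (hn : 2 * j + 1 ≤ Fintype.card α) : PuncturedNMP j D := by
  rcases Nat.lt_or_ge j 16 with hjlt | hjge
  · exact puncturedNMP_of_le_fifteen hD hj1 (by omega) hn
  rcases Nat.lt_or_ge (Fintype.card α + 2) (3 * j) with hlt | hge
  · obtain ⟨n, hcard⟩ : ∃ n, Fintype.card α = n := ⟨_, rfl⟩
    rw [hcard] at hlt hn
    interval_cases j
    · have hub : n ≤ 45 := by omega
      interval_cases n
      · exact inst3_33_16 hcard hD
      · exact inst3_34_16 hcard hD
      · exact inst3_35_16 hcard hD
      · exact inst3_36_16 hcard hD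
      · exact inst3_37_16 hcard hD
      · exact inst3_38_16 hcard hD
      · exact inst3_39_16 hcard hD
      · exact inst3_40_16 hcard hD
      · exact inst3_41_16 hcard hD
      · exact inst3_42_16 hcard hD
      · exact inst3_43_16 hcard hD
      · exact inst3_44_16 hcard hD
      · exact inst3_45_16 hcard hD
    · have hub : n ≤ 48 := by omega
      interval_cases n
      · exact inst3_35_17 hcard hD
      · exact inst3_36_17 hcard hD
      · exact inst3_37_17 hcard hD
      · exact inst3_38_17 hcard hD
      · exact inst3_39_17 hcard hD
      · exact inst3_40_17 hcard hD
      · exact inst3_41_17 hcard hD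
      · exact inst3_42_17 hcard hD
      · exact inst3_43_17 hcard hD
      · exact inst3_44_17 hcard hD
      · exact inst3_45_17 hcard hD
      · exact inst3_46_17 hcard hD
      · exact inst3_47_17 hcard hD
      · exact inst3_48_17 hcard hD
    · have hub : n ≤ 51 := by omega
      interval_cases n
      · exact inst3_37_18 hcard hD
      · exact inst3_38_18 hcard hD
      · exact inst3_39_18 hcard hD
      · exact inst3_40_18 hcard hD
      · exact inst3_41_18 hcard hD
      · exact inst3_42_18 hcard hD
      · exact inst3_43_18 hcard hD
      · exact inst3_44_18 hcard hD
      · exact inst3_45_18 hcard hD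
      · exact inst3_46_18 hcard hD
      · exact inst3_47_18 hcard hD
      · exact inst3_48_18 hcard hD
      · exact inst3_49_18 hcard hD
      · exact inst3_50_18 hcard hD
      · exact inst3_51_18 hcard hD
    · have hub : n ≤ 54 := by omega
      interval_cases n
      · exact inst3_39_19 hcard hD
      · exact inst3_40_19 hcard hD
      · exact inst3_41_19 hcard hD
      · exact inst3_42_19 hcard hD
      · exact inst3_43_19 hcard hD
      · exact inst3_44_19 hcard hD
      · exact inst3_45_19 hcard hD
      · exact inst3_46_19 hcard hD
      · exact inst3_47_19 hcard hD
      · exact inst3_48_19 hcard hD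
      · exact inst3_49_19 hcard hD
      · exact inst3_50_19 hcard hD
      · exact inst3_51_19 hcard hD
      · exact inst3_52_19 hcard hD
      · exact inst3_53_19 hcard hD
      · exact inst3_54_19 hcard hD
    · have hub : n ≤ 57 := by omega
      interval_cases n
      · exact inst3_41_20 hcard hD
      · exact inst3_42_20 hcard hD
      · exact inst3_43_20 hcard hD
      · exact inst3_44_20 hcard hD
      · exact inst3_45_20 hcard hD
      · exact inst3_46_20 hcard hD
      · exact inst3_47_20 hcard hD
      · exact inst3_48_20 hcard hD
      · exact inst3_49_20 hcard hD
      · exact inst3_50_20 hcard hD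
      · exact inst3_51_20 hcard hD
      · exact inst3_52_20 hcard hD
      · exact inst3_53_20 hcard hD
      · exact inst3_54_20 hcard hD
      · exact inst3_55_20 hcard hD
      · exact inst3_56_20 hcard hD
      · exact inst3_57_20 hcard hD
    · have hub : n ≤ 60 := by omega
      interval_cases n
      · exact inst3_43_21 hcard hD
      · exact inst3_44_21 hcard hD
      · exact inst3_45_21 hcard hD
      · exact inst3_46_21 hcard hD
      · exact inst3_47_21 hcard hD
      · exact inst3_48_21 hcard hD
      · exact inst3_49_21 hcard hD
      · exact inst3_50_21 hcard hD
      · exact inst3_51_21 hcard hD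
      · exact inst3_52_21 hcard hD
      · exact inst3_53_21 hcard hD
      · exact inst3_54_21 hcard hD
      · exact inst3_55_21 hcard hD
      · exact inst3_56_21 hcard hD
      · exact inst3_57_21 hcard hD
      · exact inst3_58_21 hcard hD
      · exact inst3_59_21 hcard hD
      · exact inst3_60_21 hcard hD
    · have hub : n ≤ 63 := by omega
      interval_cases n
      · exact inst3_45_22 hcard hD
      · exact inst3_46_22 hcard hD
      · exact inst3_47_22 hcard hD
      · exact inst3_48_22 hcard hD
      · exact inst3_49_22 hcard hD
      · exact inst3_50_22 hcard hD
      · exact inst3_51_22 hcard hD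
      · exact inst3_52_22 hcard hD
      · exact inst3_53_22 hcard hD
      · exact inst3_54_22 hcard hD
      · exact inst3_55_22 hcard hD
      · exact inst3_56_22 hcard hD
      · exact inst3_57_22 hcard hD
      · exact inst3_58_22 hcard hD
      · exact inst3_59_22 hcard hD
      · exact inst3_60_22 hcard hD
      · exact inst3_61_22 hcard hD
      · exact inst3_62_22 hcard hD
      · exact inst3_63_22 hcard hD
    · have hub : n ≤ 66 := by omega
      interval_cases n
      · exact inst3_47_23 hcard hD
      · exact inst3_48_23 hcard hD
      · exact inst3_49_23 hcard hD
      · exact inst3_50_23 hcard hD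
      · exact inst3_51_23 hcard hD
      · exact inst3_52_23 hcard hD
      · exact inst3_53_23 hcard hD
      · exact inst3_54_23 hcard hD
      · exact inst3_55_23 hcard hD
      · exact inst3_56_23 hcard hD
      · exact inst3_57_23 hcard hD
      · exact inst3_58_23 hcard hD
      · exact inst3_59_23 hcard hD
      · exact inst3_60_23 hcard hD
      · exact inst3_61_23 hcard hD
      · exact inst3_62_23 hcard hD
      · exact inst3_63_23 hcard hD
      · exact inst3_64_23 hcard hD
      · exact inst3_65_23 hcard hD
      · exact inst3_66_23 hcard hD
    · have hub : n ≤ 69 := by omega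
      interval_cases n
      · exact inst3_49_24 hcard hD
      · exact inst3_50_24 hcard hD
      · exact inst3_51_24 hcard hD
      · exact inst3_52_24 hcard hD
      · exact inst3_53_24 hcard hD
      · exact inst3_54_24 hcard hD
      · exact inst3_55_24 hcard hD
      · exact inst3_56_24 hcard hD
      · exact inst3_57_24 hcard hD
      · exact inst3_58_24 hcard hD
      · exact inst3_59_24 hcard hD
      · exact inst3_60_24 hcard hD
      · exact inst3_61_24 hcard hD
      · exact inst3_62_24 hcard hD
      · exact inst3_63_24 hcard hD
      · exact inst3_64_24 hcard hD
      · exact inst3_65_24 hcard hD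
      · exact inst3_66_24 hcard hD
      · exact inst3_67_24 hcard hD
      · exact inst3_68_24 hcard hD
      · exact inst3_69_24 hcard hD
  · exact puncturedNMP_of_three_j' hD (by omega) hn hge

omit [Fintype α] in
/-- (SP) inside any finset `E` for `1 ≤ j ≤ 24`, `2j + 1 ≤ #E`. -/
theorem puncturedNMP_in_of_le_twentyfour {E : Finset α} {j : ℕ} {D : Finset (Finset α)} (hD : IsCodeIn j E D)
    (hj1 : 1 ≤ j) (hj : j ≤ 24) (hn : 2 * j + 1 ≤ E.card) : PuncturedNMPIn j E D := by
  apply puncturedNMP_in_of_subtype hD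
  apply puncturedNMP_of_le_twentyfour (isCode_image_toSub hD) hj1 hj
  rw [Fintype.card_coe]
  exact hn

end PercRepro.PuncturedLYM

namespace PercRepro.Cogirth

open Finset ThmH Skew

variable {α : Type} [DecidableEq α] {M : Matroid α} [M.Finite]

/-- **(NC) for every sparse paving matroid of corank `n − r ≤ 24`** with `r + 1 ≤ n` and `n + 2 ≤ 2r`. -/
theorem normConsAt_of_sparsePaving_corank_le_twentyfour {r : ℕ} (hsp : IsSparsePavingF M r) (hr1 : r + 1 ≤ (gr M).card)
    (hn : (gr M).card + 2 ≤ 2 * r) (hJ : (gr M).card - r ≤ 24) : NormConsAt M := by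
  intro U hU j
  have hr : r ≤ (gr M).card := by omega
  rcases Nat.lt_or_ge j ((gr M).card - r) with hlt | hge
  · apply normConsStep_of_lt
    rw [hsp.1]
    omega
  rcases Nat.eq_or_lt_of_le hge with heq | hgt
  · rw [← heq]
    apply normConsStep_bottom_of_puncturedNMPIn hsp hn hU
    exact PuncturedLYM.puncturedNMP_in_of_le_twentyfour (isCodeIn_cocode hsp hr) (by omega) hJ (by omega)
  rcases Nat.lt_or_ge (j + 1) r with hmid | htop
  · apply normConsStep_of_indep_succ_of_indep_sdiff hU (by omega)
    · intro S hS hSc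
      exact rk_eq_card_of_card_lt_of_sparsePaving hsp hr hS (by omega)
    · intro S hS hSc
      exact rk_eq_card_of_card_lt_of_sparsePaving hsp hr hS (by omega)
  · apply normConsStep_of_rk_le hU
    rw [hsp.1]
    omega

end PercRepro.Cogirth
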